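import Literature.NumberTheory.Automorphic.UnitaryGroupPrincipalSeriesExponents   -- ★ `Representation.HasJacquetExponent`, `normalizedJacquet` (+ ★ `ParabolicTriple`)
import Literature.RepresentationTheory.Semisimple.Twist                          -- ★ `Representation.twist`
import HarnessLib

/-!
# A one-dimensional normalised Jacquet module has exactly one exponent

Topic `NumberTheory/Automorphic`; namespace `Representation` (deliberate dot-notation extensions of the tree's `Representation.HasJacquetExponent`,
as in ★ `UnitaryGroupPrincipalSeriesExponents`).  THEOREMS ONLY (no definition, no instance, no notation, no `sorry`).  Glue node G5
`one_dim_exponent_unique` ∕ (g1) of the cell's T3 statement tree (`KeysCaseTwo` pay-down, [Rogawski1990, §12.2 pp. 173–174]; [Casselman1995, §4.4, Thm. 4.4.6,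
Prop. 7.1.3]): Casselman's exponents of `π` with respect to `P` are the characters of `M` occurring as eigencharacters in `r_P(π)`; when `r_P(π)` is the
ONE-dimensional representation `θ` («`r(π) ≅ θ`», T3b's `HasJacquetChar` currency: an `M`-equivalence `r_P(π) ≃ 𝟙.twist θ`), or more generally when `M` acts
on `r_P(π)` through the single character `θ`, the only exponent is `θ`.

* `HasJacquetExponent.eq_of_forall_eq_smul` — if `M` acts on `r_P(ρ)` by the character `θ` then every exponent `χ` of `ρ` equals `θ`;
* `HasJacquetExponent.eq_of_equiv_twist_trivial` — the same from an `M`-equivalence `r_P(ρ) ≃ (trivial).twist θ` (Mathlib `Representation.Equiv`).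
-/

set_option autoImplicit false

noncomputable section

namespace Representation

open Literature.NumberTheory.Automorphic

variable {G : Type*} [Group G] [TopologicalSpace G] [IsTopologicalGroup G]
  (t : ParabolicTriple G) [LocallyCompactSpace t.P] {V : Type*} [AddCommGroup V] [Module ℂ V]

/-- **If `M` acts on the normalised Jacquet module `r_P(ρ)` through ONE character `θ`, every exponent of `ρ` is `θ`**: an exponent `χ` has a
non-zero eigenvector `w` with `r_P(ρ)(m) w = χ(m) w = θ(m) w`, so `χ(m) = θ(m)` for all `m`. [cite: Casselman1995, §4.4 p. 45] [folklore] -/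
theorem HasJacquetExponent.eq_of_forall_eq_smul {ρ : Representation ℂ G V} {θ χ : ↥t.M →* ℂˣ}
    (hθ : ∀ (m : ↥t.M) (w : (t.restrict ρ).Coinvariants), ρ.normalizedJacquet t m w = ((θ m : ℂˣ) : ℂ) • w)
    (hχ : ρ.HasJacquetExponent t χ) : χ = θ := by
  obtain ⟨w, hw0, hw⟩ := hχ
  ext m
  have h := hw m
  rw [hθ m w] at h
  -- `θ m • w = χ m • w` with `w ≠ 0`
  have h' : (((θ m : ℂˣ) : ℂ) - ((χ m : ℂˣ) : ℂ)) • w = 0 := by rw [sub_smul, h, sub_self]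
  rcases smul_eq_zero.1 h' with h1 | h1
  · exact (sub_eq_zero.1 h1).symm
  · exact absurd h1 hw0

/-- **«`r(π) ≅ θ` ⇒ the only exponent is `θ`»**: if the normalised Jacquet module is `M`-equivalent to the one-dimensional representation
`(trivial ℂ M ℂ).twist θ` (the character `θ` on `ℂ`), then every `HasJacquetExponent t ρ χ` has `χ = θ` (transport the eigen-relation along the
equivalence, which is injective). The (g1) glue of T3b's `HasJacquetChar`. [cite: Casselman1995, §4.4 p. 45] [folklore] -/
theorem HasJacquetExponent.eq_of_equiv_twist_trivial {ρ : Representation ℂ G V} {θ χ : ↥t.M →* ℂˣ}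
    (e : (ρ.normalizedJacquet t).Equiv ((Representation.trivial ℂ ↥t.M ℂ).twist θ))
    (hχ : ρ.HasJacquetExponent t χ) : χ = θ := by
  refine HasJacquetExponent.eq_of_forall_eq_smul t (fun m w => ?_) hχ
  apply e.toLinearEquiv.injective
  have h1 : e.toLinearEquiv (ρ.normalizedJacquet t m w) = ((Representation.trivial ℂ ↥t.M ℂ).twist θ) m (e.toLinearEquiv w) :=
    Representation.IntertwiningMap.isIntertwining _ _ e.toIntertwiningMap m w
  rw [h1, map_smul]
  rfl

end Representation

end
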